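import Mathlib
import Summits.ValiantsHypothesis.ValiantsHypothesis.Theses.FreeSubtorus
import Summits.ValiantsHypothesis.ValiantsHypothesis.Theorems.FreeSubtorusSubtorusCovering
import Summits.ValiantsHypothesis.ValiantsHypothesis.Cruxes.OrbitDimensionBound.Lines.ConfusionLadder
import Summits.ValiantsHypothesis.ValiantsHypothesis.Cruxes.OrbitDimensionBound.Lines.RowTorusLadder
import Summits.ValiantsHypothesis.ValiantsHypothesis.Cruxes.OrbitDimensionBound.Lines.TorsionLadder
import Summits.ValiantsHypothesis.ValiantsHypothesis.Cruxes.OrbitDimensionBound.Lines.DegreeLadder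
import Summits.ValiantsHypothesis.ValiantsHypothesis.Cruxes.OrbitDimensionBound.Lines.PowerLadder
import Literature.Computability.AlgebraicComplexity.PBoundedGrowth
import Literature.Computability.AlgebraicComplexity.EquivariantDC

/-!
# Channel ladder over the proved `SubtorusCovering` — the HUB / CHANNEL dial `ρ`
(fwd-rung g10, crux `OrbitDimensionBound`, stmt-ValiantsHypothesis-16133)

FLOOR (seed g1-ValiantsHypothesis-16134, PROVED: `Theorems.FreeSubtorusSubtorusCovering.subtorusCovering_proof`):
for `n ≥ 3`, ONE affine matrix `B` of size `m` with `det B = per_n` that is `T_Λ`-equivariant with EXACT lifts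
(`B(γx) = g B h⁻¹` for every `γ ∈ T_Λ`; `Λ ⊂ ℤⁿ ⊕ ℤⁿ` admissible, `r` generators) has `C(n,⌊n/2⌋) ≤ m · 2^r`.

THE ONE MOVE.  The floor's hypothesis "`B` is `T_Λ`-equivariant" is relaxed to "`B` is `T_Λ`-equivariant AFTER
REMOVING A CONSTANT MATRIX OF RANK `≤ ρ`": `B = B_eq + K`, `K ∈ M_m(ℂ)`, `rank K ≤ ρ`, `B_eq` affine with exact
lifts of every `γ ∈ T_Λ`, and still `det B = per_n` (`IsChannelDetRepr ρ`).  In branching-program language `K` is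
`ρ` extra constant wires ("channels", "hubs") whose endpoints ignore the torus grading of the equivariant program
`B_eq`; by the matrix determinant lemma `per_n = det B_eq + vᵀ adj(B_eq) u` (`ρ = 1`, `K = u vᵀ`): the permanent is
read off ONE equivariant affine matrix through its determinant and its first minors.

THE DIAL.  `ρ = 0` IS the floor (`channelCovering_zero_iff`, `Iff` up to `simp`; `channelCovering_zero` PROVED from
the seed); `ρ = 1` is the rung (`OneChannelCovering`, numeric; the FILED rung decl is its asymptotic shadow
`OneChannelShadow := ChannelShadow 1`, so that `S → rung` is a landed one-liner `oneChannelShadow_of_summit`);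
`ρ ≥ m` is "SOME constant shift of `B` is equivariant" (`isChannelDetRepr_iff_of_le`), which for the shift
`K = B(0)` says only that the LINEAR PART of `B` is `T_Λ`-equivariant — and that is free: subdividing every
variable edge `u →x_p→ v` of any algebraic branching program as `u →1→ a →x_p→ b →1→ v` puts every variable alone in
a fresh row `a` and a fresh column `b`, so diagonal lifts `g = diag(χ_{row})`, `h = diag(χ_{col})` exist for the
full torus (`r = 0`) at the cost of a factor `≤ 3` in size.  Hence the TOP of the dial — the hypothesis class
"channel rank unbounded" (`ChannelShadowTop`: no rank condition at all) — contains every subdivided branching program,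
and a size lower bound there is a lower bound for `dc(per_n)` itself: `ChannelShadowTop` is `VBP ≠ VNP`-hard
(documented, not filed; `channelShadowTop_of_summit` PROVED, `ChannelShadow.of_top` PROVED), while the NUMERIC members
are informative only for bounded `ρ` (their loss `(n·m)^ρ · 2^{(ρ+1) r}` is vacuous for `ρ ≳ n / log m` — the
ladder's ceiling, BC9).  The shadows interpolate: floor shadow (PROVED, `channelShadow_zero`) ← `ChannelShadow 1`
(RUNG) ← … ← `ChannelShadow ρ` ← … ← `ChannelShadowTop` ← "dc(per) is not p-bounded" (`VBP ≠ VNP`) ← `VP ≠ VNP`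
(`channelShadow_of_summit`, PROVED for every `ρ`).  The shadows are antitone in `ρ` (`ChannelShadow.anti`); each
numeric member implies its shadow (`channelShadow_of_channelCovering`, via `2^n ≤ (n+1)·C(n,⌊n/2⌋)`).

NUMERIC SHAPE.  `ChannelCovering ρ : C(n,⌊n/2⌋) ≤ m · (n·m)^ρ · 2^{(ρ+1) r}`.  Heuristic behind the exponents
(line card, stub `stub_channelCount`): `ρ` channels raise the corank of the constant part of `B_eq` to `≤ ρ + 1`,
so a Leibniz term of a minor of the graded matrix `B_eq` carries the `n` variable cells of a permutation on
`≤ ρ + 2` vertex-disjoint GRADED chains (graded cycles carry no variables: the generic element has no non-negative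
multiplicative relation, `stub_genericElement` (ii)); reading the torus weight at total depth `⌊n/2⌋` across
`≤ ρ + 1` chains costs a factor `m` (reference points = channel exits) and a factor `2^r` (Odlyzko confusion,
`stub_classCount`) per chain, and `≤ n` for the depth split.

RELAXED TARGET.  `OrbitChannelBound ρ`: every affine determinantal expression of `per_n` admits a same-size
`ρ`-channel-equivariant re-expression under an admissible `T_Λ` with `(ρ+1)·r ≤ n/2`; `ρ = 0` is implied by the
host crux `OrbitDimensionBound` (`orbitChannelBound_zero_of_orbitDimensionBound`), and
`closes_channel : OrbitChannelBound 1 → OneChannelCovering → VP ≠ VNP` is PROVED (quadratic-loss glue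
`vh_of_eventual_quadratic_loss`: `C(n,⌊n/2⌋) ≤ n · dc(per_n)² · 2^{⌊n/2⌋}` for large `n` ⇒ `(33/32)^n ≤ dc(per_n)`
⇒ VH by `expDcGlue_proof`).

[cite: LandsbergRessayre2017, Thm. 2.8, Question 2.2, §6] [cite: Burgisser2000, Def. 2.1, Thm. 2.10]
[cite: MignonRessayre2004] [folklore: matrix determinant lemma; ABP subdivision]
-/

set_option linter.dupNamespace false
set_option linter.unusedVariables false

namespace Summit.ValiantsHypothesis.ValiantsHypothesis.Cruxes.OrbitDimensionBound.Channel

open Literature.Computability.AlgebraicComplexity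
open Summit.ValiantsHypothesis.ValiantsHypothesis.Cruxes.OrbitDimensionBound.Confusion
open Summit.ValiantsHypothesis.ValiantsHypothesis.Cruxes.OrbitDimensionBound.Torsion (torusGen subtorus)
open Summit.ValiantsHypothesis.ValiantsHypothesis.Cruxes.OrbitDimensionBound.RowTorus (powShadow_floor coveringShadow_mono)
open Summit.ValiantsHypothesis.ValiantsHypothesis.Cruxes.OrbitDimensionBound.Degree (two_pow_le_succ_mul_choose_middle nine_pow_bound')
open MvPolynomial

noncomputable section

/-! ## §1 Channel-equivariant determinantal expressions -/

section General

variable {k : Type*} [Field k] {σ : Type*} [Fintype σ] [DecidableEq σ]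

/-- **`IsChannelDetRepr ρ Γ f A`** — `A` is an affine determinantal expression of `f` (`det A = f`, entries of
degree `≤ 1`) which becomes `Γ`-EQUIVARIANT WITH EXACT LIFTS AFTER REMOVING A CONSTANT MATRIX OF RANK `≤ ρ`:
there are `s ≤ ρ`, `U ∈ k^{m×s}`, `V ∈ k^{s×m}` such that `A - U V` satisfies
`(A - UV)(γx) = g · (A - UV) · h⁻¹` (`g, h ∈ GL_m(k)`) for every `γ ∈ Γ`.  `ρ = 0` is `IsEquivariantDetRepr`
(`isChannelDetRepr_zero_iff`); `ρ ≥ m` allows any constant shift (`isChannelDetRepr_iff_of_le`).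
[cite: LandsbergRessayre2017, Def. 2.4] [folklore] -/
def IsChannelDetRepr (ρ : ℕ) (Γ : Subgroup (GL σ k)) (f : MvPolynomial σ k) {m : ℕ}
    (A : Matrix (Fin m) (Fin m) (MvPolynomial σ k)) : Prop :=
  IsAffineDetRepr f A ∧
    ∃ (s : ℕ) (U : Matrix (Fin m) (Fin s) k) (V : Matrix (Fin s) (Fin m) k), s ≤ ρ ∧
      ∀ γ ∈ Γ, ∃ g h : GL (Fin m) k,
        Matrix.linSubstEntries γ (A - (U * V).map C) =
          (g : Matrix (Fin m) (Fin m) k).map C * (A - (U * V).map C) *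
            ((h⁻¹ : GL (Fin m) k) : Matrix (Fin m) (Fin m) k).map C

variable {ρ ρ' : ℕ} {Γ Γ' : Subgroup (GL σ k)} {f : MvPolynomial σ k} {m : ℕ}
  {A : Matrix (Fin m) (Fin m) (MvPolynomial σ k)}

theorem IsChannelDetRepr.isAffineDetRepr (h : IsChannelDetRepr ρ Γ f A) : IsAffineDetRepr f A := h.1

/-- The dial is monotone in `ρ` (harder-to-easier hypothesis). [folklore] -/
theorem IsChannelDetRepr.mono (h : IsChannelDetRepr ρ Γ f A) (hle : ρ ≤ ρ') : IsChannelDetRepr ρ' Γ f A := by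
  obtain ⟨hA, s, U, V, hs, hγ⟩ := h
  exact ⟨hA, s, U, V, hs.trans hle, hγ⟩

/-- Fewer symmetries are easier to lift. [folklore] -/
theorem IsChannelDetRepr.anti (h : IsChannelDetRepr ρ Γ f A) (hle : Γ' ≤ Γ) : IsChannelDetRepr ρ Γ' f A := by
  obtain ⟨hA, s, U, V, hs, hγ⟩ := h
  exact ⟨hA, s, U, V, hs, fun γ hγ' => hγ γ (hle hγ')⟩

/-- A product through `k^0` is the zero matrix. [folklore] -/
theorem mul_fin_zero_eq_zero (U : Matrix (Fin m) (Fin 0) k) (V : Matrix (Fin 0) (Fin m) k) : U * V = 0 := by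
  ext i j
  simp [Matrix.mul_apply]

/-- **`ρ = 0` is exact equivariance**: `IsChannelDetRepr 0 Γ f A ↔ IsEquivariantDetRepr Γ f A`. [folklore] -/
theorem isChannelDetRepr_zero_iff : IsChannelDetRepr 0 Γ f A ↔ IsEquivariantDetRepr Γ f A := by
  constructor
  · rintro ⟨hA, s, U, V, hs, hγ⟩
    obtain rfl : s = 0 := Nat.le_zero.mp hs
    have h0 : U * V = 0 := mul_fin_zero_eq_zero U V
    refine ⟨hA, fun γ hγ' => ?_⟩
    obtain ⟨g, h, e⟩ := hγ γ hγ'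
    refine ⟨g, h, ?_⟩
    simpa [h0, Matrix.map_zero] using e
  · rintro ⟨hA, hγ⟩
    refine ⟨hA, 0, 0, 0, le_rfl, fun γ hγ' => ?_⟩
    obtain ⟨g, h, e⟩ := hγ γ hγ'
    refine ⟨g, h, ?_⟩
    simpa [Matrix.map_zero] using e

/-- Exact equivariance is channel-equivariance for every `ρ`. [folklore] -/
theorem IsChannelDetRepr.of_isEquivariantDetRepr (h : IsEquivariantDetRepr Γ f A) (ρ : ℕ) :
    IsChannelDetRepr ρ Γ f A :=
  (isChannelDetRepr_zero_iff.2 h).mono (Nat.zero_le ρ)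

/-- **Top of the dial**: for `ρ ≥ m` the rank condition is void — `IsChannelDetRepr ρ Γ f A` says that SOME constant
shift `A - K` of `A` is `Γ`-equivariant with exact lifts. [folklore] -/
theorem isChannelDetRepr_iff_of_le (hm : m ≤ ρ) :
    IsChannelDetRepr ρ Γ f A ↔ IsAffineDetRepr f A ∧ ∃ K : Matrix (Fin m) (Fin m) k,
      ∀ γ ∈ Γ, ∃ g h : GL (Fin m) k,
        Matrix.linSubstEntries γ (A - K.map C) =
          (g : Matrix (Fin m) (Fin m) k).map C * (A - K.map C) *
            ((h⁻¹ : GL (Fin m) k) : Matrix (Fin m) (Fin m) k).map C := by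
  constructor
  · rintro ⟨hA, s, U, V, hs, hγ⟩
    exact ⟨hA, U * V, hγ⟩
  · rintro ⟨hA, K, hγ⟩
    refine ⟨hA, m, K, 1, hm, ?_⟩
    simpa only [Matrix.mul_one] using hγ

end General

/-! ## §2 The graded numeric family `ChannelCovering ρ`, the floor `ρ = 0`, the numeric rung `ρ = 1` -/

/-- **The graded family `ChannelCovering ρ`** (dial = the channel rank `ρ`).  For `n ≥ 3`: every affine matrix `B` of
size `m` with `det B = per_n` that is `T_Λ`-equivariant with exact lifts after removing a constant matrix of rank
`≤ ρ` (`Λ` admissible with `r` generators; the subtorus is the floor's, VERBATIM, via `Torsion.subtorus`) satisfies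
`C(n, ⌊n/2⌋) ≤ m · (n·m)^ρ · 2^{(ρ+1)·r}`.  `ρ = 0` is the floor `SubtorusCovering` (`channelCovering_zero_iff`).
[cite: LandsbergRessayre2017, Thm. 2.8, §6] -/
def ChannelCovering (ρ : ℕ) : Prop :=
  ∀ n : ℕ, 3 ≤ n → ∀ (m r : ℕ) (Λ : Fin r → (Fin n ⊕ Fin n) → ℤ)
    (B : Matrix (Fin m) (Fin m) (MvPolynomial (Fin n × Fin n) ℂ)),
    (∀ i, (∑ k, Λ i (Sum.inl k)) = 0 ∧ (∑ l, Λ i (Sum.inr l)) = 0) →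
    IsChannelDetRepr ρ (subtorus n r Λ) (perPoly (Fin n) ℂ) B →
    Nat.choose n (n / 2) ≤ m * (n * m) ^ ρ * 2 ^ ((ρ + 1) * r)

/-- **THE NUMERIC RUNG `OneChannelCovering`** (`ρ = 1`: one channel `K = u vᵀ`): for `n ≥ 3`,
`C(n, ⌊n/2⌋) ≤ n · m² · 4^r`. [cite: LandsbergRessayre2017, §6] -/
def OneChannelCovering : Prop := ChannelCovering 1

/-- The member `ρ = 0` of the family IS the floor statement (up to `x^0 = 1`, `1·r = r` and
`isChannelDetRepr_zero_iff`). [folklore] -/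
theorem channelCovering_zero_iff :
    ChannelCovering 0 ↔ Summit.ValiantsHypothesis.ValiantsHypothesis.Theses.FreeSubtorus.SubtorusCovering := by
  constructor
  · intro h n hn m r Λ B hΛ hB
    have h' := h n hn m r Λ B hΛ (isChannelDetRepr_zero_iff.2 hB)
    simpa using h'
  · intro h n hn m r Λ B hΛ hB
    have h' := h n hn m r Λ B hΛ (isChannelDetRepr_zero_iff.1 hB)
    simpa using h'

/-- **The floor is proved** (seed g1-ValiantsHypothesis-16134). [cite: LandsbergRessayre2017, Thm. 2.8] -/
theorem channelCovering_zero : ChannelCovering 0 :=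
  channelCovering_zero_iff.2
    Summit.ValiantsHypothesis.ValiantsHypothesis.Theorems.FreeSubtorusSubtorusCovering.subtorusCovering_proof

/-- The numeric rung unfolded: `C(n,⌊n/2⌋) ≤ m · (n·m) · 2^{2r}`. [folklore] -/
theorem oneChannelCovering_iff :
    OneChannelCovering ↔ ∀ n : ℕ, 3 ≤ n → ∀ (m r : ℕ) (Λ : Fin r → (Fin n ⊕ Fin n) → ℤ)
      (B : Matrix (Fin m) (Fin m) (MvPolynomial (Fin n × Fin n) ℂ)),
      (∀ i, (∑ k, Λ i (Sum.inl k)) = 0 ∧ (∑ l, Λ i (Sum.inr l)) = 0) →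
      IsChannelDetRepr 1 (subtorus n r Λ) (perPoly (Fin n) ℂ) B →
      Nat.choose n (n / 2) ≤ m * (n * m) * 2 ^ (2 * r) := by
  simp only [OneChannelCovering, ChannelCovering, pow_one]

/-! ## §3 The asymptotic shadows `ChannelShadow ρ` (THE FILED RUNG is `OneChannelShadow`) and `S → shadow` -/

/-- **Asymptotic shadow `ChannelShadow ρ`.**  Along ANY sequence of admissible lattice data `Λ_n` (`r_n` generators)
and `ρ`-channel `T_{Λ_n}`-equivariant affine determinantal expressions `B_n` of `per_n` of sizes `m_n` (`n ≥ 3`),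
`n ↦ m_n · 2^{r_n}` is not p-bounded.  `ρ = 0` is the floor's shadow `CoveringShadow powLoss`
(`channelShadow_zero_iff`). [cite: LandsbergRessayre2017, Question 2.2] [cite: Burgisser2000, Def. 2.1] -/
def ChannelShadow (ρ : ℕ) : Prop :=
  ∀ (m r : ℕ → ℕ) (Λ : (n : ℕ) → Fin (r n) → (Fin n ⊕ Fin n) → ℤ)
    (B : (n : ℕ) → Matrix (Fin (m n)) (Fin (m n)) (MvPolynomial (Fin n × Fin n) ℂ)),
    (∀ n : ℕ, 3 ≤ n →
      (∀ i, (∑ k, Λ n i (Sum.inl k)) = 0 ∧ (∑ l, Λ n i (Sum.inr l)) = 0) ∧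
      IsChannelDetRepr ρ (subtorus n (r n) (Λ n)) (perPoly (Fin n) ℂ) (B n)) →
    ¬ IsPBounded (fun n => m n * 2 ^ (r n))

/-- **THE RUNG (filed decl) `OneChannelShadow := ChannelShadow 1`**: no sequence of ONE-channel `T_{Λ_n}`-equivariant
affine determinantal expressions of `per_n` (admissible `Λ_n`, `r_n` generators, sizes `m_n`) has `m_n · 2^{r_n}`
p-bounded. [cite: LandsbergRessayre2017, Question 2.2] -/
def OneChannelShadow : Prop := ChannelShadow 1

/-- `ρ = 0`: the shadow of the floor, literally. [folklore] -/
theorem channelShadow_zero_iff : ChannelShadow 0 ↔ CoveringShadow powLoss := by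
  constructor
  · intro h m r Λ B hyp
    exact h m r Λ B fun n hn => ⟨(hyp n hn).1, isChannelDetRepr_zero_iff.2 (hyp n hn).2⟩
  · intro h m r Λ B hyp
    exact h m r Λ B fun n hn => ⟨(hyp n hn).1, isChannelDetRepr_zero_iff.1 (hyp n hn).2⟩

/-- **The floor's shadow is a theorem** (`RowTorus.powShadow_floor`). [cite: LandsbergRessayre2017, Thm. 2.8] -/
theorem channelShadow_zero : ChannelShadow 0 := channelShadow_zero_iff.2 powShadow_floor

/-- Dial monotonicity of the shadows: `ρ ≤ ρ' ⇒ ChannelShadow ρ' → ChannelShadow ρ` (a `ρ`-channel expression is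
a `ρ'`-channel expression). [folklore] -/
theorem ChannelShadow.anti {ρ ρ' : ℕ} (hle : ρ ≤ ρ') (h : ChannelShadow ρ') : ChannelShadow ρ :=
  fun m r Λ B hyp => h m r Λ B fun n hn => ⟨(hyp n hn).1, (hyp n hn).2.mono hle⟩

/-- Rung ⇒ floor (shadow form), by monotonicity of the dial. [folklore] -/
theorem channelShadow_zero_of_oneChannelShadow (h : OneChannelShadow) : ChannelShadow 0 :=
  ChannelShadow.anti (Nat.zero_le 1) h

/-- Rung ⇒ the floor's shadow in the host's currency. [folklore] -/
theorem powShadow_of_oneChannelShadow (h : OneChannelShadow) : CoveringShadow powLoss :=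
  channelShadow_zero_iff.1 (channelShadow_zero_of_oneChannelShadow h)

/-- **Numeric member ⇒ its shadow**: `C(n,⌊n/2⌋) ≤ m (nm)^ρ 2^{(ρ+1)r} ≤ n^ρ · (m 2^r)^{ρ+1}` and
`2^n ≤ (n+1) C(n,⌊n/2⌋)`, so a p-bounded `m_n 2^{r_n}` would make `2^n` p-bounded up to a polynomial factor.
[cite: Burgisser2000, Def. 2.1] -/
theorem channelShadow_of_channelCovering {ρ : ℕ} (h : ChannelCovering ρ) : ChannelShadow ρ := by
  intro m r Λ B hyp hPB
  -- t n := m n * 2^(r n);  the numeric bound gives 2^n ≤ (n+1)^(ρ+1) * t n ^ (ρ+1) for n ≥ 3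
  have hT : IsPBounded (fun n => (m n * 2 ^ (r n)) ^ (ρ + 1)) := IsPBounded.pow_holds hPB (ρ + 1)
  refine not_isPBounded_of_two_pow_le (ρ + 1) 3 (fun n hn => ?_) hT
  have hnum := h n hn (m n) (r n) (Λ n) (B n) (hyp n hn).1 (hyp n hn).2
  have h1 : m n * (n * m n) ^ ρ * 2 ^ ((ρ + 1) * r n) ≤ (n + 1) ^ ρ * (m n * 2 ^ (r n)) ^ (ρ + 1) := by
    have e : m n * (n * m n) ^ ρ * 2 ^ ((ρ + 1) * r n) = n ^ ρ * (m n * 2 ^ (r n)) ^ (ρ + 1) := by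
      rw [pow_mul, mul_pow, mul_pow]; ring
    rw [e]
    exact Nat.mul_le_mul_right _ (Nat.pow_le_pow_left (Nat.le_succ n) ρ)
  calc 2 ^ n ≤ (n + 1) * Nat.choose n (n / 2) := two_pow_le_succ_mul_choose_middle n
    _ ≤ (n + 1) * ((n + 1) ^ ρ * (m n * 2 ^ (r n)) ^ (ρ + 1)) := Nat.mul_le_mul_left _ (hnum.trans h1)
    _ = (n + 1) ^ (ρ + 1) * (m n * 2 ^ (r n)) ^ (ρ + 1) := by ring

/-- Numeric rung ⇒ filed rung. [folklore] -/
theorem oneChannelShadow_of_oneChannelCovering (h : OneChannelCovering) : OneChannelShadow :=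
  channelShadow_of_channelCovering h

/-- **ON-PATH LEMMA `S → shadow`** (every `ρ`): `VP_ℂ ≠ VNP_ℂ` implies `ChannelShadow ρ`.  Only `det B_n = per_n`
(entries affine) is used: `dc(per_n) ≤ m_n ≤ m_n 2^{r_n}`; a p-bounded `dc(per)` makes `per` a `VP` family
(`isVPFamily_of_isPBounded_determinantalComplexity`), hence `VP = VNP` (`perFamily_mem_VP_iff_VP_eq_VNP`).
[cite: Burgisser2000, Thm. 2.10, §2.5] [cite: Valiant1979] -/
theorem channelShadow_of_summit (ρ : ℕ) (hS : _root_.ValiantsHypothesis) : ChannelShadow ρ := by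
  intro m r Λ B hyp hPB
  have hdc : IsPBounded (fun n => determinantalComplexity (perPoly (Fin n) ℂ)) := by
    refine IsPBounded.of_eventually_le 3 hPB fun n hn => ?_
    have hrep : HasDetRepr (perPoly (Fin n) ℂ) (m n) := ⟨B n, (hyp n hn).2.1⟩
    calc determinantalComplexity (perPoly (Fin n) ℂ) ≤ m n := determinantalComplexity_le_of_hasDetRepr hrep
      _ = m n * 1 := (mul_one _).symm
      _ ≤ m n * 2 ^ (r n) := Nat.mul_le_mul_left _ Nat.one_le_two_pow
  have hι : IsPBounded (fun n => Fintype.card (Fin n × Fin n)) :=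
    (IsPBounded.mul_holds IsPBounded.id IsPBounded.id).mono fun n => by simp
  have hVP : IsVPFamily (fun n => perPoly (Fin n) ℂ) :=
    Summit.ValiantsHypothesis.Theorems.DeterminantalRigidityReductions.isVPFamily_of_isPBounded_determinantalComplexity
      hι hdc
  have hmem : perFamily ℂ ∈ VP ℂ := (mem_VP_ofFintype_iff_holds (fun n => perPoly (Fin n) ℂ)).2 hVP
  have hEq : VP ℂ = VNP ℂ := (perFamily_mem_VP_iff_VP_eq_VNP ℂ ringChar_complex_ne_two).1 hmem
  exact hS hEq

/-- **`S → rung`**: `ValiantsHypothesis → OneChannelShadow` (for the forward funnel's on-path check; `aesop`-visible).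
[cite: Burgisser2000, Thm. 2.10] -/
@[aesop safe apply]
theorem oneChannelShadow_of_summit (hS : _root_.ValiantsHypothesis) : OneChannelShadow :=
  channelShadow_of_summit 1 hS

/-- **Top of the dial `ChannelShadowTop`** — NO rank condition on the constant defect (`ρ = m_n`): along any sequence
of affine determinantal expressions `B_n` of `per_n` (sizes `m_n`) SOME constant shift of which is `T_{Λ_n}`-equivariant
with exact lifts (`Λ_n` admissible, `r_n` generators), `m_n 2^{r_n}` is not p-bounded.  By ABP subdivision (module
docstring) this hypothesis class contains, up to a factor `3` in size and with `r = 0`, every algebraic branching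
program for `per_n`; the statement is therefore `VBP ≠ VNP`-hard (documented, not filed). [cite: Burgisser2000, §2.5] -/
def ChannelShadowTop : Prop :=
  ∀ (m r : ℕ → ℕ) (Λ : (n : ℕ) → Fin (r n) → (Fin n ⊕ Fin n) → ℤ)
    (B : (n : ℕ) → Matrix (Fin (m n)) (Fin (m n)) (MvPolynomial (Fin n × Fin n) ℂ)),
    (∀ n : ℕ, 3 ≤ n →
      (∀ i, (∑ k, Λ n i (Sum.inl k)) = 0 ∧ (∑ l, Λ n i (Sum.inr l)) = 0) ∧
      IsChannelDetRepr (m n) (subtorus n (r n) (Λ n)) (perPoly (Fin n) ℂ) (B n)) →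
    ¬ IsPBounded (fun n => m n * 2 ^ (r n))

/-- Every member of the dial follows from its top: a `ρ`-channel expression is an `m`-channel one (re-factor the
defect `U V` as `(U V) · 1` through `k^m`). [folklore] -/
theorem ChannelShadow.of_top (h : ChannelShadowTop) (ρ : ℕ) : ChannelShadow ρ := by
  intro m r Λ B hyp
  refine h m r Λ B fun n hn => ⟨(hyp n hn).1, ?_⟩
  obtain ⟨hA, s, U, V, hs, hγ⟩ := (hyp n hn).2
  exact ⟨hA, m n, U * V, 1, le_rfl, by simpa only [Matrix.mul_one] using hγ⟩

/-- `S →` top of the dial (same one-liner as `channelShadow_of_summit`: only `det B_n = per_n` is used).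
[cite: Burgisser2000, Thm. 2.10] -/
theorem channelShadowTop_of_summit (hS : _root_.ValiantsHypothesis) : ChannelShadowTop := by
  intro m r Λ B hyp hPB
  have hdc : IsPBounded (fun n => determinantalComplexity (perPoly (Fin n) ℂ)) := by
    refine IsPBounded.of_eventually_le 3 hPB fun n hn => ?_
    have hrep : HasDetRepr (perPoly (Fin n) ℂ) (m n) := ⟨B n, (hyp n hn).2.1⟩
    calc determinantalComplexity (perPoly (Fin n) ℂ) ≤ m n := determinantalComplexity_le_of_hasDetRepr hrep
      _ = m n * 1 := (mul_one _).symm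
      _ ≤ m n * 2 ^ (r n) := Nat.mul_le_mul_left _ Nat.one_le_two_pow
  have hι : IsPBounded (fun n => Fintype.card (Fin n × Fin n)) :=
    (IsPBounded.mul_holds IsPBounded.id IsPBounded.id).mono fun n => by simp
  have hVP : IsVPFamily (fun n => perPoly (Fin n) ℂ) :=
    Summit.ValiantsHypothesis.Theorems.DeterminantalRigidityReductions.isVPFamily_of_isPBounded_determinantalComplexity
      hι hdc
  have hmem : perFamily ℂ ∈ VP ℂ := (mem_VP_ofFintype_iff_holds (fun n => perPoly (Fin n) ℂ)).2 hVP
  have hEq : VP ℂ = VNP ℂ := (perFamily_mem_VP_iff_VP_eq_VNP ℂ ringChar_complex_ne_two).1 hmem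
  exact hS hEq

/-! ## §4 The relaxed symmetrisation target and the closing -/

/-- **`OrbitChannelBound ρ`** — the symmetrisation target RELAXED by the dial: for `n ≥ 3`, every affine determinantal
expression `A` of `per_n` of size `m` can be replaced by a `ρ`-CHANNEL `T_Λ`-equivariant one, `B`, of the same size
(`B - K` has exact lifts for some constant `K` of rank `≤ ρ`), `Λ` admissible with `(ρ + 1) · r ≤ n/2` relations.
`ρ = 0` is implied by the host crux `OrbitDimensionBound` (`orbitChannelBound_zero_of_orbitDimensionBound`).
[cite: LandsbergRessayre2017, Question 2.2, §6] -/
def OrbitChannelBound (ρ : ℕ) : Prop :=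
  ∀ n : ℕ, 3 ≤ n → ∀ (m : ℕ) (A : Matrix (Fin m) (Fin m) (MvPolynomial (Fin n × Fin n) ℂ)),
    IsAffineDetRepr (perPoly (Fin n) ℂ) A →
    ∃ (B : Matrix (Fin m) (Fin m) (MvPolynomial (Fin n × Fin n) ℂ)) (r : ℕ) (Λ : Fin r → (Fin n ⊕ Fin n) → ℤ),
      (ρ + 1) * r ≤ n / 2 ∧
      (∀ i, (∑ k, Λ i (Sum.inl k)) = 0 ∧ (∑ l, Λ i (Sum.inr l)) = 0) ∧
      IsChannelDetRepr ρ (subtorus n r Λ) (perPoly (Fin n) ℂ) B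

/-- The host crux implies the `ρ = 0` target (`K = 0`, `1 · r = r`). [folklore] -/
theorem orbitChannelBound_zero_of_orbitDimensionBound
    (h : Summit.ValiantsHypothesis.ValiantsHypothesis.Theses.FreeSubtorus.OrbitDimensionBound) :
    OrbitChannelBound 0 := by
  intro n hn m A hA
  obtain ⟨B, r, Λ, hr, hΛ, hB⟩ := h n hn m A hA
  refine ⟨B, r, Λ, by simpa using hr, hΛ, ?_⟩
  exact IsChannelDetRepr.of_isEquivariantDetRepr hB 0

/-- **Eventual middle bound with QUADRATIC loss ⇒ VH**: if `C(n, ⌊n/2⌋) ≤ n · dc(per_n)² · 2^{⌊n/2⌋}` for all large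
`n` then `VP_ℂ ≠ VNP_ℂ`.  Arithmetic `(9/8)^n ≤ dc(per_n)²` for `n ≥ 40` exactly as in
`Power.vh_of_eventual_linear_loss`, then `(33/32)^{2} ≤ 9/8` gives `(33/32)^n ≤ dc(per_n)` and `expDcGlue_proof`
concludes. [cite: Burgisser2000, Thm. 2.10, Rem. 2.11] -/
theorem vh_of_eventual_quadratic_loss (n₀ : ℕ)
    (hstep : ∀ n : ℕ, n₀ ≤ n →
      Nat.choose n (n / 2) ≤ n * (determinantalComplexity (perPoly (Fin n) ℂ) ^ 2 * 2 ^ (n / 2))) :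
    _root_.ValiantsHypothesis := by
  apply Summit.ValiantsHypothesis.Theorems.expDcGlue_proof
  refine ⟨33 / 32, by norm_num, max n₀ 40, fun n hn => ?_⟩
  have hn₀ : n₀ ≤ n := le_trans (le_max_left _ _) hn
  have h40 : 40 ≤ n := le_trans (le_max_right _ _) hn
  have hs := hstep n hn₀
  have hA := nine_pow_bound' n h40
  have hB : 2 ^ n ≤ (n + 1) * Nat.choose n (n / 2) := two_pow_le_succ_mul_choose_middle n
  set D : ℕ := determinantalComplexity (perPoly (Fin n) ℂ) with hD
  have hsR : (Nat.choose n (n / 2) : ℝ) ≤ (n : ℝ) * (((D : ℝ) ^ 2) * (2 : ℝ) ^ (n / 2)) := by exact_mod_cast hs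
  have hAR : (9 : ℝ) ^ n * (2 : ℝ) ^ (n / 2) * (((n : ℝ) + 1) * (n : ℝ)) ≤ (16 : ℝ) ^ n := by exact_mod_cast hA
  have hBR : (2 : ℝ) ^ n ≤ ((n : ℝ) + 1) * (Nat.choose n (n / 2) : ℝ) := by exact_mod_cast hB
  have hnpos : (0 : ℝ) < (n : ℝ) := by exact_mod_cast (show 0 < n by omega)
  have hposP : (0 : ℝ) < (8 : ℝ) ^ n * (2 : ℝ) ^ (n / 2) * (((n : ℝ) + 1) * (n : ℝ)) := by positivity
  have h8 : (0 : ℝ) ≤ (8 : ℝ) ^ n := by positivity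
  have hn1 : (0 : ℝ) ≤ (n : ℝ) + 1 := by positivity
  have key : (9 / 8 : ℝ) ^ n * ((8 : ℝ) ^ n * (2 : ℝ) ^ (n / 2) * (((n : ℝ) + 1) * (n : ℝ))) ≤
      ((D : ℝ) ^ 2) * ((8 : ℝ) ^ n * (2 : ℝ) ^ (n / 2) * (((n : ℝ) + 1) * (n : ℝ))) := by
    have e1 : (9 / 8 : ℝ) ^ n * ((8 : ℝ) ^ n * (2 : ℝ) ^ (n / 2) * (((n : ℝ) + 1) * (n : ℝ))) =
        (9 : ℝ) ^ n * (2 : ℝ) ^ (n / 2) * (((n : ℝ) + 1) * (n : ℝ)) := by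
      rw [div_pow]; field_simp
    have e2 : (16 : ℝ) ^ n = (8 : ℝ) ^ n * (2 : ℝ) ^ n := by rw [← mul_pow]; norm_num
    rw [e1]
    calc (9 : ℝ) ^ n * (2 : ℝ) ^ (n / 2) * (((n : ℝ) + 1) * (n : ℝ)) ≤ (16 : ℝ) ^ n := hAR
      _ = (8 : ℝ) ^ n * (2 : ℝ) ^ n := e2
      _ ≤ (8 : ℝ) ^ n * (((n : ℝ) + 1) * (Nat.choose n (n / 2) : ℝ)) := mul_le_mul_of_nonneg_left hBR h8
      _ ≤ (8 : ℝ) ^ n * (((n : ℝ) + 1) * ((n : ℝ) * (((D : ℝ) ^ 2) * (2 : ℝ) ^ (n / 2)))) := by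
          apply mul_le_mul_of_nonneg_left _ h8
          exact mul_le_mul_of_nonneg_left hsR hn1
      _ = ((D : ℝ) ^ 2) * ((8 : ℝ) ^ n * (2 : ℝ) ^ (n / 2) * (((n : ℝ) + 1) * (n : ℝ))) := by ring
  have h98 : (9 / 8 : ℝ) ^ n ≤ (D : ℝ) ^ 2 := le_of_mul_le_mul_right key hposP
  -- square root: (33/32)^2 ≤ 9/8
  have hsq : ((33 / 32 : ℝ) ^ n) ^ 2 ≤ (D : ℝ) ^ 2 := by
    calc ((33 / 32 : ℝ) ^ n) ^ 2 = ((33 / 32 : ℝ) ^ 2) ^ n := by rw [← pow_mul, ← pow_mul, mul_comm]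
      _ ≤ (9 / 8 : ℝ) ^ n := pow_le_pow_left₀ (by positivity) (by norm_num) n
      _ ≤ (D : ℝ) ^ 2 := h98
  have hDnn : (0 : ℝ) ≤ (D : ℝ) := by positivity
  have h33 : (0 : ℝ) ≤ (33 / 32 : ℝ) ^ n := by positivity
  exact (pow_le_pow_iff_left₀ h33 hDnn two_ne_zero).1 hsq

/-- **Relaxed target + numeric rung ⇒ VH**: for `n ≥ 3`, an optimal expression `A` of `per_n`
(`hasDetRepr_determinantalComplexity_holds`) is re-expressed as a one-channel `T_Λ`-equivariant `B` of the same size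
`dc(per_n)` with `2 r ≤ ⌊n/2⌋`; the rung gives `C(n,⌊n/2⌋) ≤ dc · (n · dc) · 2^{2r} ≤ n · dc² · 2^{⌊n/2⌋}`;
`vh_of_eventual_quadratic_loss` concludes. [cite: LandsbergRessayre2017, Question 2.2] [cite: Burgisser2000, Thm. 2.10] -/
theorem closes_channel (h₁ : OrbitChannelBound 1) (h₂ : OneChannelCovering) : _root_.ValiantsHypothesis := by
  refine vh_of_eventual_quadratic_loss 3 fun n hn => ?_
  obtain ⟨A, hA⟩ := hasDetRepr_determinantalComplexity_holds (perPoly (Fin n) ℂ)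
  obtain ⟨B, r, Λ, hr, hΛ, hB⟩ := h₁ n hn _ A hA
  have hcov := h₂ n hn _ r Λ B hΛ hB
  have h2r : 2 ^ ((1 + 1) * r) ≤ 2 ^ (n / 2) := Nat.pow_le_pow_right (by norm_num) hr
  calc n.choose (n / 2)
      ≤ determinantalComplexity (perPoly (Fin n) ℂ) * (n * determinantalComplexity (perPoly (Fin n) ℂ)) ^ 1 *
          2 ^ ((1 + 1) * r) := hcov
    _ ≤ determinantalComplexity (perPoly (Fin n) ℂ) * (n * determinantalComplexity (perPoly (Fin n) ℂ)) ^ 1 *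
          2 ^ (n / 2) := Nat.mul_le_mul_left _ h2r
    _ = n * (determinantalComplexity (perPoly (Fin n) ℂ) ^ 2 * 2 ^ (n / 2)) := by ring

/-- The floor also closes with the `ρ = 0` target (host route, for the record). [cite: LandsbergRessayre2017, Question 2.2] -/
theorem closes_floor (h₁ : OrbitChannelBound 0) : _root_.ValiantsHypothesis := by
  refine Summit.ValiantsHypothesis.ValiantsHypothesis.Cruxes.OrbitDimensionBound.Power.vh_of_eventual_linear_loss 3
    fun n hn => ?_
  obtain ⟨A, hA⟩ := hasDetRepr_determinantalComplexity_holds (perPoly (Fin n) ℂ)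
  obtain ⟨B, r, Λ, hr, hΛ, hB⟩ := h₁ n hn _ A hA
  have hcov := channelCovering_zero n hn _ r Λ B hΛ hB
  have hr' : r ≤ n / 2 := by simpa using hr
  have h2r : 2 ^ ((0 + 1) * r) ≤ 2 ^ (n / 2) := Nat.pow_le_pow_right (by norm_num) (by simpa using hr')
  have hn1 : 1 ≤ n := by omega
  calc n.choose (n / 2)
      ≤ determinantalComplexity (perPoly (Fin n) ℂ) * (n * determinantalComplexity (perPoly (Fin n) ℂ)) ^ 0 *
          2 ^ ((0 + 1) * r) := hcov
    _ ≤ determinantalComplexity (perPoly (Fin n) ℂ) * (n * determinantalComplexity (perPoly (Fin n) ℂ)) ^ 0 *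
          2 ^ (n / 2) := Nat.mul_le_mul_left _ h2r
    _ = 1 * (determinantalComplexity (perPoly (Fin n) ℂ) * 2 ^ (n / 2)) := by ring
    _ ≤ n * (determinantalComplexity (perPoly (Fin n) ℂ) * 2 ^ (n / 2)) := Nat.mul_le_mul_right _ hn1

end

end Summit.ValiantsHypothesis.ValiantsHypothesis.Cruxes.OrbitDimensionBound.Channel
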